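import Mathlib.RingTheory.PowerSeries.Substitution
import Mathlib.RingTheory.PowerSeries.Expand
import Mathlib.RingTheory.PowerSeries.Derivative
import Mathlib.RingTheory.PowerSeries.Trunc
import Mathlib.RingTheory.PowerSeries.Order
import Mathlib.RingTheory.PowerSeries.NoZeroDivisors
import Mathlib.Algebra.Polynomial.Taylor
import Mathlib.Algebra.CharP.Frobenius
import Mathlib.Algebra.CharP.Quotient
import Mathlib.RingTheory.Ideal.Quotient.Basic
import Mathlib.NumberTheory.Padics.RingHoms
import Mathlib.RingTheory.WittVector.Identities
import Mathlib.RingTheory.WittVector.Domain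
import Mathlib.FieldTheory.Perfect
import Literature.NumberTheory.EllipticCurves.DivisionPolynomialFormalMulProofs
import Literature.NumberTheory.EllipticCurves.FormalGroupHasseInvariantProofs
import Literature.RingTheory.FormalGroups.FunctionalEquationIntegrality
import Literature.NumberTheory.EllipticCurves.FormalGroupMultiplicationUniversalProofs
import Literature.NumberTheory.EllipticCurves.FormalGroupLogHomProofs
import Literature.RingTheory.FormalGroups.HondaTypeTransport
import Literature.NumberTheory.EllipticCurves.FormalMulTwoSecondCoeffProofs
import Mathlib.RingTheory.WittVector.FrobeniusFractionField
import Mathlib.RingTheory.WittVector.Compare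
import Mathlib.FieldTheory.Finite.Basic
import Literature.NumberTheory.EllipticCurves.FormalLogExpBaseChangeProofs
import Summits.BirchSwinnertonDyer.BirchSwinnertonDyer.Theorems.EisensteinDepletionAtTwoStarGO2KEtaWittFrac
import HarnessLib

/-!
# THEOREM K (the 2-adic Kummer class law for `z²(x(z) − x₀)`), kernel formalisation — KEtaTheoremKWittA
(crux `StarGO2Sigma`, stmt-BirchSwinnertonDyer-27046; line kummer, research stub `stub_discrepancyCover`)

Planner bsd-rank2-p2 GEN 36–37's K-UNIV / K-ETA kernel files (HOME/p2/g37/lean, memo K-UNIV.md; monolith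
`KummerTheoremK_full.lean`, lean rc 0, 0 sorries), landed by the lead star-p1 GEN 12 in ≤ 400-line parts, verbatim except for
file packaging.  This part: THEOREM K over `𝕎(k̄)`, unconditional (`TheoremKWitt.theoremK_witt` with `compFn`), and Lemma 2 = the Dwork exponential square class at 2 (`ExpClass.frob_exp_eq`, `exp_neg_two_mul_class`).
Nothing here reads `r_an`; `StarGO2Sigma` / E1M / BSD are NOT proved by this file.
-/

set_option linter.dupNamespace false
set_option linter.unusedSectionVars false
set_option autoImplicit false

noncomputable section

/-! ## THEOREM K over `𝕎(k̄)` — unconditional (the comparison function supplied by (K-h)) -/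

namespace Summit.BirchSwinnertonDyer.BirchSwinnertonDyer.Theorems.DepletionAtTwo.KEta.TheoremKWitt

open PowerSeries Literature.RingTheory.FormalGroups

variable (k : Type*) [Field k] [IsAlgClosed k] [CharP k 2] [Algebra ℚ (FractionRing (WittVector 2 k))]

/-- **The comparison function** `F₀ = exp(c₀·log_W) ∈ 𝕎(k)⟦X⟧` of an integral Weierstrass
equation `W/ℤ` of Honda type `2 − aT + T²` at `2`, `α` the unit root. [K-UNIV.md §2.8] -/
def compFn (W : WeierstrassCurve ℤ) (a : ℤ) {α : ℤ_[2]} (hαn : ‖α‖ = 1)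
    (hroot : (α : ℚ_[2]) ^ 2 - a * α + 2 = 0)
    (hH : ∀ n, ‖coeff n (hondaShift 2 (a : ℚ_[2]) (W.map (Int.castRingHom ℚ_[2])).formalLog)‖ ≤ 1) :
    PowerSeries (WittVector 2 k) :=
  (WittExistence.exists_map_eq_exp_subst k W a hαn hroot hH).choose

/-- K-UNIV kernel lemma (THEOREM K formalisation, p2 GEN 37); see the file docstring. [folklore] -/
theorem map_compFn (W : WeierstrassCurve ℤ) (a : ℤ) {α : ℤ_[2]} (hαn : ‖α‖ = 1)
    (hroot : (α : ℚ_[2]) ^ 2 - a * α + 2 = 0)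
    (hH : ∀ n, ‖coeff n (hondaShift 2 (a : ℚ_[2]) (W.map (Int.castRingHom ℚ_[2])).formalLog)‖ ≤ 1) :
    PowerSeries.map (algebraMap (WittVector 2 k) (FractionRing (WittVector 2 k)))
        (compFn k W a hαn hroot hH) =
      (exp (FractionRing (WittVector 2 k))).subst
        (C (algebraMap (WittVector 2 k) (FractionRing (WittVector 2 k))
            (WittExistence.period (k := k) (PadicInt.isUnit_iff.mpr hαn))) *
          (W.map (Int.castRingHom (FractionRing (WittVector 2 k)))).formalLog) :=
  (WittExistence.exists_map_eq_exp_subst k W a hαn hroot hH).choose_spec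

/-- `F₀ ↦ expLog(W_K, c₀)` in the shape consumed by `TheoremK.theoremK`. -/
theorem map_compFn_eq_expLog (W : WeierstrassCurve ℤ) (a : ℤ) {α : ℤ_[2]} (hαn : ‖α‖ = 1)
    (hroot : (α : ℚ_[2]) ^ 2 - a * α + 2 = 0)
    (hH : ∀ n, ‖coeff n (hondaShift 2 (a : ℚ_[2]) (W.map (Int.castRingHom ℚ_[2])).formalLog)‖ ≤ 1) :
    PowerSeries.map (algebraMap (WittVector 2 k) (FractionRing (WittVector 2 k)))
        (compFn k W a hαn hroot hH) =
      ExpSide.expLog ((W.map (Int.castRingHom (WittVector 2 k))).map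
          (algebraMap (WittVector 2 k) (FractionRing (WittVector 2 k))))
        (algebraMap (WittVector 2 k) (FractionRing (WittVector 2 k))
          (WittExistence.period (k := k) (PadicInt.isUnit_iff.mpr hαn))) := by
  unfold ExpSide.expLog
  rw [WeierstrassCurve.map_map, RingHom.ext_int ((algebraMap (WittVector 2 k)
    (FractionRing (WittVector 2 k))).comp (Int.castRingHom (WittVector 2 k)))
    (Int.castRingHom (FractionRing (WittVector 2 k)))]
  exact map_compFn k W a hαn hroot hH

/-- `F₀ ∘ [2] = F₀²`. [K-UNIV.md §2.6] -/
theorem compFn_subst_formalMul_two (W : WeierstrassCurve ℤ) (a : ℤ) {α : ℤ_[2]} (hαn : ‖α‖ = 1)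
    (hroot : (α : ℚ_[2]) ^ 2 - a * α + 2 = 0)
    (hH : ∀ n, ‖coeff n (hondaShift 2 (a : ℚ_[2]) (W.map (Int.castRingHom ℚ_[2])).formalLog)‖ ≤ 1) :
    (compFn k W a hαn hroot hH).subst ((W.map (Int.castRingHom (WittVector 2 k))).formalMul 2) =
      compFn k W a hαn hroot hH ^ 2 :=
  ExpSide.subst_formalMul_eq_pow_of_map (algebraMap (WittVector 2 k) (FractionRing (WittVector 2 k)))
    (IsFractionRing.injective _ _) _ (map_compFn_eq_expLog k W a hαn hroot hH) 2

/-- `F₀' = c₀ · ω_W · F₀`. [K-UNIV.md §2.6] -/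
theorem derivative_compFn (W : WeierstrassCurve ℤ) (a : ℤ) {α : ℤ_[2]} (hαn : ‖α‖ = 1)
    (hroot : (α : ℚ_[2]) ^ 2 - a * α + 2 = 0)
    (hH : ∀ n, ‖coeff n (hondaShift 2 (a : ℚ_[2]) (W.map (Int.castRingHom ℚ_[2])).formalLog)‖ ≤ 1) :
    d⁄dX (WittVector 2 k) (compFn k W a hαn hroot hH) =
      C (WittExistence.period (k := k) (PadicInt.isUnit_iff.mpr hαn)) *
        (W.map (Int.castRingHom (WittVector 2 k))).formalInvDiff * compFn k W a hαn hroot hH :=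
  ExpSide.derivative_eq_of_map (algebraMap (WittVector 2 k) (FractionRing (WittVector 2 k)))
    (IsFractionRing.injective _ _) _ (map_compFn_eq_expLog k W a hαn hroot hH)

/-- The auxiliary `B` (`2B = 4x₀² + b₂x₀ + b₄`) exists as soon as `a₁` is odd and `x̄₀ = ā₃`
(`b₂ ≡ a₁²`, `b₄ ≡ a₁a₃ (mod 2)`), in any setting with `ker π = 2O`. [folklore] -/
theorem exists_half {O k' : Type*} [CommRing O] [CommRing k'] [CharP k' 2] {π : O →+* k'}
    (hker : ∀ a : O, π a = 0 ↔ ∃ b : O, a = 2 * b) (W : WeierstrassCurve O) {x₀ : O}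
    (ha1 : π W.a₁ = 1) (hx0 : π x₀ = π W.a₃) :
    ∃ B : O, 2 * B = 4 * x₀ ^ 2 + W.b₂ * x₀ + W.b₄ := by
  have h2 : (2 : k') = 0 := by
    have := CharP.cast_eq_zero k' 2
    exact_mod_cast this
  have h0 : π (4 * x₀ ^ 2 + W.b₂ * x₀ + W.b₄) = 0 := by
    simp only [WeierstrassCurve.b₂, WeierstrassCurve.b₄, map_add, map_mul, map_pow, map_ofNat, ha1,
      hx0, one_pow, one_mul]
    linear_combination (2 * π W.a₃ ^ 2 + 2 * π W.a₂ * π W.a₃ + π W.a₄ + π W.a₃) * h2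
  obtain ⟨B, hB⟩ := (hker _).mp h0
  exact ⟨B, hB.symm⟩

/-- **THEOREM K (unconditional, over `𝕎(k̄)`; K-UNIV.md §2.10).** `k` algebraically closed of
characteristic `2`, `W/ℤ` an integral Weierstrass equation with `a₁` odd whose `2`-adic formal
logarithm is of Honda type `2 − aT + T²` with unit root `α` (ordinary reduction), `[2]_W ≢ 0 (mod 2)`,
`x₀ ∈ 𝕎(k)` a `2`-torsion abscissa (`ΨSq₂(x₀) = 0`) with `x̄₀ = ā₃` and `2B = 4x₀² + b₂x₀ + b₄`
solvable.  Let `F₀ = exp(c₀ log_W) ∈ 𝕎(k)⟦X⟧` be the comparison function (`compFn`).  Then for EVERY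
`z ∈ X𝕎(k)⟦X⟧` and any Dwork witnesses of `g∘z` (`g = X²(x(X) − x₀)`) and `F₀∘z` w.r.t. the Witt
Frobenius: `δ(g∘z)̄ · (F̄₀∘z̄)² = δ(F₀∘z)̄ · (ḡ∘z̄)²` in `k⟦X⟧` — the `2`-adic Kummer classes of
`g∘z` and `F₀∘z` coincide. -/
theorem theoremK_witt (W : WeierstrassCurve ℤ) (a : ℤ) {α : ℤ_[2]} (hαn : ‖α‖ = 1)
    (hroot : (α : ℚ_[2]) ^ 2 - a * α + 2 = 0)
    (hH : ∀ n, ‖coeff n (hondaShift 2 (a : ℚ_[2]) (W.map (Int.castRingHom ℚ_[2])).formalLog)‖ ≤ 1)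
    {x₀ B : WittVector 2 k}
    (hx : 4 * x₀ ^ 3 + (W.map (Int.castRingHom (WittVector 2 k))).b₂ * x₀ ^ 2 +
      2 * (W.map (Int.castRingHom (WittVector 2 k))).b₄ * x₀ +
        (W.map (Int.castRingHom (WittVector 2 k))).b₆ = 0)
    (hB : 2 * B = 4 * x₀ ^ 2 + (W.map (Int.castRingHom (WittVector 2 k))).b₂ * x₀ +
      (W.map (Int.castRingHom (WittVector 2 k))).b₄)
    (ha1 : WittVector.constantCoeff (W.map (Int.castRingHom (WittVector 2 k))).a₁ = 1)
    (hx0 : WittVector.constantCoeff x₀ =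
      WittVector.constantCoeff (W.map (Int.castRingHom (WittVector 2 k))).a₃)
    (h2 : PowerSeries.map (WittVector.constantCoeff : WittVector 2 k →+* k)
      ((W.map (Int.castRingHom (WittVector 2 k))).formalMul 2) ≠ 0)
    {z δgz δFz : PowerSeries (WittVector 2 k)} (hz0 : constantCoeff z = 0)
    (hgz : Kernel.phi (WittVector.frobenius : WittVector 2 k →+* WittVector 2 k)
        (((W.map (Int.castRingHom (WittVector 2 k))).formalXMulSq - C x₀ * X ^ 2).subst z) =
      (((W.map (Int.castRingHom (WittVector 2 k))).formalXMulSq - C x₀ * X ^ 2).subst z) ^ 2 +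
        2 * δgz)
    (hFz : Kernel.phi (WittVector.frobenius : WittVector 2 k →+* WittVector 2 k)
        ((compFn k W a hαn hroot hH).subst z) = ((compFn k W a hαn hroot hH).subst z) ^ 2 + 2 * δFz) :
    PowerSeries.map (WittVector.constantCoeff : WittVector 2 k →+* k) δgz *
        (PowerSeries.map (WittVector.constantCoeff : WittVector 2 k →+* k)
          ((compFn k W a hαn hroot hH).subst z)) ^ 2 =
      PowerSeries.map (WittVector.constantCoeff : WittVector 2 k →+* k) δFz *
        (PowerSeries.map (WittVector.constantCoeff : WittVector 2 k →+* k)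
          (((W.map (Int.castRingHom (WittVector 2 k))).formalXMulSq - C x₀ * X ^ 2).subst z)) ^ 2 := by
  obtain ⟨h2r, hker, hfrob⟩ := Kernel.frobeniusLift_wittVector k
  have hc : WittVector.constantCoeff (WittExistence.period (k := k) (PadicInt.isUnit_iff.mpr hαn)) = 1 := by
    rw [WittVector.constantCoeff_apply]; exact WittExistence.coeff_zero_period _
  exact TheoremK.theoremK h2r hker hfrob
    (algebraMap (WittVector 2 k) (FractionRing (WittVector 2 k))) (IsFractionRing.injective _ _)
    (W.map (Int.castRingHom (WittVector 2 k))) hx hB ha1 hx0 h2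
    (map_compFn_eq_expLog k W a hαn hroot hH) hc hz0 hgz hFz

end Summit.BirchSwinnertonDyer.BirchSwinnertonDyer.Theorems.DepletionAtTwo.KEta.TheoremKWitt


/-! # PART Lemma 2 (GEN 36 DworkExpClass): the Dwork exponential square class at 2 -/


/-!
# The square class of a Dwork exponential at `p = 2` (K-ETA Lemma 2)

Planner p2 GEN 36, cell bsd-rank2; crux `StarGO2Sigma` (stmt-BirchSwinnertonDyer-27046); K-ETA.md §4 Lemma 2 in the tree's
abstract setting of `Literature/RingTheory/FormalGroups/FunctionalEquationIntegrality.lean` (`K` a `ℚ`-algebra, `A ≤ K` a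
subring containing `1/m` for odd `m`, `α : K →+* K`; Frobenius lift on series `φ(u) = expand₂(α_* u) = (α_* u)(X²)`).

For `F = exp(a)` with Dwork's functional equation `expand₂(α_* a) = 2a − 2w`, `w ∈ XA⟦X⟧` (so `F ∈ 1 + XA⟦X⟧` by the
tree's `coeff_exp_subst_mem_of_functionalEquation`):

* `frob_exp_eq` (EXACT): `φ(F) = F² · exp(−2w)`;
* `exp_neg_two_mul_class` (the CLASS): `exp(−2w) = 1 + 2s` with `s ∈ A⟦X⟧` and **`s − s² ≡ w (mod 2A⟦X⟧)`** — i.e. the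
  `2`-adic square class `D(F) = s̄ = (φF − F²)/(2F²) mod 2` satisfies `s̄ − s̄² = w̄`, equivalently `s̄ = Σ_{j ≥ 0} w̄^{2^j}`
  in `(A/2A)⟦X⟧` (K-ETA.md §4 Lemma 2: `D(exp a) = S(w̄)`).

The proof of the class is the coefficient identity `exp(4w′) − 4exp(2w′) + 3 + 4w′ = Σ_{d ≥ 3} (2^d(2^d − 4)/d!)·w′^d ∈ 8A⟦X⟧`
(`w′ = −w`; `2^d/d! ∈ 2ℤ₍₂₎`, tree `exists_pow_mul_inv_factorial_eq`), combined with `exp(4w′) = exp(2w′)²`.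
Pure proof file; no definitions of record; nothing here reads `r_an`; BSD is not proved by this file.
-/



open PowerSeries
open Literature.RingTheory.FormalGroups

namespace Summit.BirchSwinnertonDyer.BirchSwinnertonDyer.Theorems.DepletionAtTwo.KEta.ExpClass

variable {K : Type*} [CommRing K] [Algebra ℚ K] (A : Subring K) (α : K →+* K)

/-! ### §0 Helpers -/

/-- Summing `q`-multiples of elements of `A`. [folklore] -/
theorem exists_sum_eq_mul (q : K) (t : Finset ℕ) (f : ℕ → K)
    (h : ∀ d ∈ t, ∃ a ∈ A, f d = q * a) : ∃ a ∈ A, t.sum f = q * a := by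
  induction t using Finset.induction_on with
  | empty => exact ⟨0, zero_mem A, by rw [Finset.sum_empty, mul_zero]⟩
  | insert d t hdt ih =>
    obtain ⟨a, ha, hs⟩ := ih (fun d' hd' => h d' (Finset.mem_insert_of_mem hd'))
    obtain ⟨b, hb, h'⟩ := h d (Finset.mem_insert_self d t)
    exact ⟨b + a, add_mem hb ha, by rw [Finset.sum_insert hdt, hs, h', mul_add]⟩

/-- The finite-sum formula for the coefficients of `exp(r·w)`, `w(0) = 0`:
`[Xⁿ] exp(r w) = Σ_{d < N} (1/d!) r^d [Xⁿ] w^d` for any `N > n`. [folklore] -/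
theorem coeff_exp_subst_smul_eq_sum (r : K) {w : K⟦X⟧} (hw0 : constantCoeff w = 0) (n N : ℕ) (hN : n < N) :
    coeff n ((exp K).subst (r • w)) =
      (Finset.range N).sum fun d => algebraMap ℚ K (1 / (d.factorial : ℕ)) * (r ^ d * coeff n (w ^ d)) := by
  have hrw0 : constantCoeff (r • w) = 0 := by rw [smul_eq_C_mul, map_mul, hw0, mul_zero]
  rw [coeff_subst' (HasSubst.of_constantCoeff_zero' hrw0),
    finsum_eq_sum_of_support_subset _ (s := Finset.range N)]
  · refine Finset.sum_congr rfl fun d _ => ?_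
    rw [coeff_exp, smul_pow, coeff_smul, smul_eq_mul, smul_eq_mul]
  · intro d hd
    rw [Function.mem_support] at hd
    rw [Finset.coe_range, Set.mem_Iio]
    by_contra h
    apply hd
    have h0 : coeff n ((r • w) ^ d) = 0 := by
      refine coeff_of_lt_order _ (lt_of_lt_of_le (show ((n : ℕ) : ℕ∞) < (d : ℕ∞) by
        exact_mod_cast lt_of_lt_of_le hN (not_lt.mp h)) (le_trans ?_ (le_order_pow _ d)))
      have h1 : (1 : ℕ∞) ≤ (r • w).order := (one_le_order_iff_constCoeff_eq_zero).mpr hrw0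
      calc (d : ℕ∞) = d • (1 : ℕ∞) := by simp
        _ ≤ d • (r • w).order := nsmul_le_nsmul_right h1 d
    rw [h0, smul_zero]

/-- Coefficients of powers of an `A`-integral series are in `A`. [folklore] -/
theorem coeff_pow_mem {w : K⟦X⟧} (hw : ∀ n, coeff n w ∈ A) (d n : ℕ) : coeff n (w ^ d) ∈ A := by
  obtain ⟨W, hW⟩ := exists_map_subtype_eq_of_coeff_mem A hw
  rw [← hW, ← map_pow]; exact coeff_map_subtype_mem A _ _

/-- The scalar `λ_d := (4^d − 4·2^d)/d! + κ_d` (`κ₀ = 3`, `κ₁ = 4`, `κ_d = 0` else) is `8 ×` an element of `A`: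
it vanishes for `d ≤ 2` and equals `8 · (2^{d−2} − 1) · (2^d/(2·d!))` for `d ≥ 3`. [folklore] -/
theorem exists_lambda_eq_eight_mul (hA : ∀ m : ℕ, ¬ 2 ∣ m → algebraMap ℚ K (1 / m) ∈ A) (d : ℕ) :
    ∃ c ∈ A, algebraMap ℚ K (1 / (d.factorial : ℕ)) * ((4 : K) ^ d - 4 * 2 ^ d) +
      (if d = 0 then 3 else if d = 1 then 4 else 0) = 8 * c := by
  haveI : Fact (Nat.Prime 2) := ⟨Nat.prime_two⟩
  rcases Nat.lt_or_ge d 3 with hd | hd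
  · interval_cases d
    · exact ⟨0, zero_mem A, by norm_num [Nat.factorial]⟩
    · exact ⟨0, zero_mem A, by norm_num [Nat.factorial]⟩
    · exact ⟨0, zero_mem A, by norm_num [Nat.factorial]⟩
  · obtain ⟨c, hc, h⟩ := exists_pow_mul_inv_factorial_eq 2 A hA (d := d) (by omega)
    obtain ⟨e, rfl⟩ : ∃ e, d = e + 3 := ⟨d - 3, by omega⟩
    have h2A : (2 : K) ∈ A := by have := natCast_mem A 2; exact_mod_cast this
    refine ⟨(2 ^ (e + 1) - 1) * c, mul_mem (sub_mem (pow_mem h2A _) (one_mem A)) hc, ?_⟩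
    rw [if_neg (by omega), if_neg (by omega), add_zero]
    have h4 : (4 : K) ^ (e + 3) - 4 * 2 ^ (e + 3) = ((2 : ℕ) : K) ^ (e + 3) * (4 * (2 ^ (e + 1) - 1)) := by
      push_cast
      rw [show (4 : K) = 2 ^ 2 by norm_num, ← pow_mul]
      ring
    rw [h4, ← mul_assoc, mul_comm (algebraMap ℚ K _), h]
    push_cast; ring

/-! ### §1 The exact identity `φ(exp a) = exp(a)² · exp(−2w)` -/

/-- From the tree's functional-equation form `w = a − ½·expand₂(α_* a)` to `expand₂(α_* a) = 2a − 2w`. [folklore] -/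
theorem expand_map_eq_of_sub_smul (a : K⟦X⟧) :
    expand 2 two_ne_zero (a.map α) = 2 * a - 2 * (a - (2 : ℚ)⁻¹ • expand 2 two_ne_zero (a.map α)) := by
  set y := expand 2 two_ne_zero (a.map α)
  have h2 : (2 : K⟦X⟧) * ((2 : ℚ)⁻¹ • y) = y := by
    rw [← algebraMap_smul K (2 : ℚ)⁻¹ y, smul_eq_C_mul, ← mul_assoc,
      show (2 : K⟦X⟧) = C (2 : K) from (map_ofNat C 2).symm, ← map_mul,
      show (2 : K) * algebraMap ℚ K (2 : ℚ)⁻¹ = 1 by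
        rw [← map_ofNat (algebraMap ℚ K) 2, ← map_mul, mul_inv_cancel₀ (two_ne_zero), map_one],
      map_one, one_mul]
  linear_combination -h2

/-- **`φ(exp a) = exp(a)²·exp(−2w)`** when `expand₂(α_* a) = 2a − 2w` (`a(0) = w(0) = 0`). [this memo, K-ETA.md §4 Lemma 2] -/
theorem frob_exp_eq {a w : K⟦X⟧} (ha0 : constantCoeff a = 0) (hw0 : constantCoeff w = 0)
    (hy : expand 2 two_ne_zero (a.map α) = 2 * a - 2 * w) :
    expand 2 two_ne_zero (PowerSeries.map α ((exp K).subst a)) = ((exp K).subst a) ^ 2 * (exp K).subst ((2 : K) • (-w)) := by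
  have hαa0 : constantCoeff (a.map α) = 0 := by
    rw [← coeff_zero_eq_constantCoeff, coeff_map, coeff_zero_eq_constantCoeff, ha0, map_zero]
  have hX0 : constantCoeff ((X : K⟦X⟧) ^ 2) = 0 := by simp
  have hnw0 : constantCoeff (-w) = 0 := by rw [map_neg, hw0, neg_zero]
  have h2w0 : constantCoeff ((2 : K) • (-w)) = 0 := by rw [smul_eq_C_mul, map_mul, hnw0, mul_zero]
  have h2a0 : constantCoeff ((2 : ℕ) • a) = 0 := by rw [map_nsmul, ha0, smul_zero]
  rw [map_exp_subst α ha0, expand_apply, exp_subst_subst hαa0 hX0, ← expand_apply, hy,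
    show (2 : K⟦X⟧) * a - 2 * w = (2 : ℕ) • a + (2 : K) • (-w) by
      rw [nsmul_eq_mul, Nat.cast_ofNat, smul_eq_C_mul, show (C (2 : K) : K⟦X⟧) = 2 from map_ofNat C 2]; ring,
    exp_subst_add h2a0 h2w0, exp_subst_nsmul ha0 2]
  exact two_ne_zero

/-! ### §2 The class: `exp(−2w) = 1 + 2s`, `s − s² ≡ w (mod 2A⟦X⟧)` -/

/-- **K-ETA Lemma 2 (Dwork exponential square class at `2`).** For `w ∈ XA⟦X⟧` (`A ∋ 1/m` for odd `m`):
`exp(−2w) = 1 + 2s` with `s ∈ A⟦X⟧` and `s − s² − w ∈ 2A⟦X⟧`; hence the class `s̄ ∈ (A/2)⟦X⟧` is `Σ_j w̄^{2^j}`.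
[this memo, K-ETA.md §4 Lemma 2] [tree: Literature.RingTheory.FormalGroups.exists_coeff_exp_subst_mul_eq, exists_pow_mul_inv_factorial_eq] -/
theorem exp_neg_two_mul_class (hA : ∀ m : ℕ, ¬ 2 ∣ m → algebraMap ℚ K (1 / m) ∈ A)
    {w : K⟦X⟧} (hw0 : constantCoeff w = 0) (hw : ∀ n, coeff n w ∈ A) :
    ∃ s : K⟦X⟧, (∀ n, coeff n s ∈ A) ∧ (exp K).subst ((2 : K) • (-w)) = 1 + 2 * s ∧
      ∀ n, ∃ b ∈ A, coeff n (s - s ^ 2 - w) = 2 * b := by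
  haveI : Fact (Nat.Prime 2) := ⟨Nat.prime_two⟩
  set w' : K⟦X⟧ := -w with hw'def
  have hw'0 : constantCoeff w' = 0 := by rw [hw'def, map_neg, hw0, neg_zero]
  have hw' : ∀ n, coeff n w' ∈ A := fun n => by rw [hw'def, map_neg]; exact neg_mem (hw n)
  -- `E₁ = exp(2w')`, its coefficients `1, 2c₀, 2c₁, …`
  set E₁ : K⟦X⟧ := (exp K).subst ((2 : K) • w') with hE₁
  have hE₁' : E₁ = (exp K).subst (((2 : ℕ) : K) • w') := by rw [hE₁, Nat.cast_ofNat]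
  choose c hc hcE using fun n => exists_coeff_exp_subst_mul_eq 2 A hA hw'0 hw' n
  set s : K⟦X⟧ := X * PowerSeries.mk c with hs
  have hs_coeff : ∀ n, coeff n s ∈ A := fun n => by
    cases n with
    | zero => rw [hs, coeff_zero_X_mul]; exact zero_mem A
    | succ n => rw [hs, coeff_succ_X_mul, coeff_mk]; exact hc n
  have hE₁s : E₁ = 1 + 2 * s := by
    ext n
    cases n with
    | zero =>
      rw [coeff_zero_eq_constantCoeff, hE₁, constantCoeff_exp_subst
        (by rw [smul_eq_C_mul, map_mul, hw'0, mul_zero])]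
      rw [map_add, map_one, map_mul, hs, map_mul, constantCoeff_X, zero_mul, mul_zero, add_zero]
    | succ n =>
      rw [hE₁', hcE n, map_add, coeff_one, if_neg (Nat.succ_ne_zero n), zero_add,
        show (2 : K⟦X⟧) = C (2 : K) from (map_ofNat C 2).symm, coeff_C_mul, hs, coeff_succ_X_mul, coeff_mk,
        Nat.cast_ofNat]
  -- `E₂ = exp(4w') = E₁²`
  set E₂ : K⟦X⟧ := (exp K).subst ((4 : K) • w') with hE₂
  have hE₂sq : E₂ = E₁ ^ 2 := by
    rw [hE₁, ← exp_subst_nsmul (by rw [smul_eq_C_mul, map_mul, hw'0, mul_zero]) 2, hE₂, two_nsmul, ← add_smul]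
    norm_num
  -- `Z := E₂ − 4E₁ + 3 + 4w' ∈ 8A⟦X⟧`
  have hZ : ∀ n, ∃ b ∈ A, coeff n (E₂ - 4 * E₁ + 3 + 4 * w') = 8 * b := by
    intro n
    have h1 := coeff_exp_subst_smul_eq_sum (2 : K) hw'0 n (n + 3) (by omega)
    have h2 := coeff_exp_subst_smul_eq_sum (4 : K) hw'0 n (n + 3) (by omega)
    have hκ : (3 : K) * coeff n (1 : K⟦X⟧) + 4 * coeff n w' = (Finset.range (n + 3)).sum fun d =>
        (if d = 0 then (3 : K) else if d = 1 then 4 else 0) * coeff n (w' ^ d) := by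
      rw [Finset.sum_range_succ', Finset.sum_range_succ', Finset.sum_eq_zero (fun d _ => by
        rw [if_neg (by omega), if_neg (by omega), zero_mul])]
      simp only [zero_add, if_true, show (0 + 1 : ℕ) = 1 from rfl, one_ne_zero, if_false, pow_zero, pow_one]
      ring
    have hcoef : coeff n (E₂ - 4 * E₁ + 3 + 4 * w') = (Finset.range (n + 3)).sum fun d =>
        (algebraMap ℚ K (1 / (d.factorial : ℕ)) * ((4 : K) ^ d - 4 * 2 ^ d) +
          (if d = 0 then (3 : K) else if d = 1 then 4 else 0)) * coeff n (w' ^ d) := by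
      rw [map_add, map_add, map_sub, hE₂, h2, show (4 : K⟦X⟧) * E₁ = C (4 : K) * E₁ by
          rw [show (C (4 : K) : K⟦X⟧) = 4 from map_ofNat C 4], coeff_C_mul, hE₁, h1,
        show (3 : K⟦X⟧) = C (3 : K) * 1 by rw [mul_one]; exact (map_ofNat C 3).symm, coeff_C_mul,
        show (4 : K⟦X⟧) * w' = C (4 : K) * w' by rw [show (C (4 : K) : K⟦X⟧) = 4 from map_ofNat C 4],
        coeff_C_mul, add_assoc, hκ, Finset.mul_sum, ← Finset.sum_sub_distrib, ← Finset.sum_add_distrib]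
      refine Finset.sum_congr rfl fun d _ => ?_
      ring
    rw [hcoef]
    refine exists_sum_eq_mul A 8 _ _ fun d _ => ?_
    obtain ⟨e, he, hl⟩ := exists_lambda_eq_eight_mul A hA d
    exact ⟨e * coeff n (w' ^ d), mul_mem he (coeff_pow_mem A hw' d n), by rw [hl, mul_assoc]⟩
  -- `Z = −4(s − s² + w)` and cancellation of `4`
  have hZT : E₂ - 4 * E₁ + 3 + 4 * w' = -4 * (s - s ^ 2 - w) - 8 * w := by
    rw [hE₂sq, hE₁s, hw'def]; ring
  refine ⟨s, hs_coeff, hE₁s, fun n => ?_⟩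
  obtain ⟨b, hb, hbZ⟩ := hZ n
  refine ⟨-b - coeff n w, sub_mem (neg_mem hb) (hw n), ?_⟩
  have h4 : (4 : K) * coeff n (s - s ^ 2 - w) = 4 * (2 * (-b - coeff n w)) := by
    have := hbZ
    rw [hZT, map_sub, show (-4 : K⟦X⟧) * (s - s ^ 2 - w) = C (-4 : K) * (s - s ^ 2 - w) by
        rw [map_neg, map_ofNat], coeff_C_mul,
      show (8 : K⟦X⟧) * w = C (8 : K) * w by rw [map_ofNat], coeff_C_mul] at this
    linear_combination -this
  have h4u : IsUnit (4 : K) := by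
    have : (4 : K) = algebraMap ℚ K 4 := by rw [map_ofNat]
    rw [this]; exact (IsUnit.mk0 (4 : ℚ) (by norm_num)).map _
  exact h4u.mul_left_cancel h4

/-- **K-ETA Lemma 2, assembled.** For `a ∈ XK⟦X⟧` with Dwork's functional equation `expand₂(α_* a) = 2a − 2w`,
`w ∈ XA⟦X⟧`: `φ(exp a) = exp(a)²·(1 + 2s)` with `s ∈ A⟦X⟧`, `s − s² ≡ w (mod 2A⟦X⟧)`.
[this memo, K-ETA.md §4 Lemma 2] -/
theorem frob_exp_class (hA : ∀ m : ℕ, ¬ 2 ∣ m → algebraMap ℚ K (1 / m) ∈ A)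
    {a w : K⟦X⟧} (ha0 : constantCoeff a = 0) (hw0 : constantCoeff w = 0) (hw : ∀ n, coeff n w ∈ A)
    (hy : expand 2 two_ne_zero (a.map α) = 2 * a - 2 * w) :
    ∃ s : K⟦X⟧, (∀ n, coeff n s ∈ A) ∧
      expand 2 two_ne_zero (PowerSeries.map α ((exp K).subst a)) = ((exp K).subst a) ^ 2 * (1 + 2 * s) ∧
      ∀ n, ∃ b ∈ A, coeff n (s - s ^ 2 - w) = 2 * b := by
  obtain ⟨s, hs, hE, hcl⟩ := exp_neg_two_mul_class A hA hw0 hw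
  exact ⟨s, hs, by rw [frob_exp_eq α ha0 hw0 hy, hE], hcl⟩

end Summit.BirchSwinnertonDyer.BirchSwinnertonDyer.Theorems.DepletionAtTwo.KEta.ExpClass

end
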